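import Literature.Probability.Percolation.ArmSeparationSlotDisjoint
import HarnessLib

/-!
# Slot events: the corridors land the two arms

Topic: Probability / Percolation; family `crit-perc`. A brick of the discharge of
`Literature.Probability.Percolation.Nolin2008_twoArm_separation` (Nolin 2008, Thm. 11
[arXiv 0711.4948: Thm. 10]; `ArmSeparation.lean`), landing step of the internal extremities
(Nolin 2008, Prop. 12 (iii)–(i) [arXiv Prop. 11]). For a valid rung and a slot in range,
admissible and separated, the routing of `ArmSeparationSlotDefs.lean` meets the hypotheses of the
landing moves (`landing_move`, `white_landing_move`): the entry piece of each colour lies in its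
arc and is met by its spoke (`spokeMeets_pieceTube`), the exit run lies in the arc and spans the
target rows, and the sizes fit. Hence
`blackArm σ ∩ blackCorr σ ⊆ sepOpenArm n N` and `whiteArm σ ∩ whiteCorr σ ⊆ negFlip ⁻¹' sepOpenArm n N`,
so that all four slot events together force `sepTwoArm n N` (`Slot.inter_subset_sepTwoArm`).

## References

* P. Nolin, *Near-critical percolation in two dimensions*, Electron. J. Probab. 13 (2008), §4.2
  Def. 6–8, §4.3 Prop. 12, §4.4 [arXiv 0711.4948: Def. 6–8, Prop. 11, Thm. 10]. [Nolin2008]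
* H. Kesten, *Scaling relations for 2D-percolation*, Comm. Math. Phys. 109 (1987), Lemma 2. [Kesten1987]
-/

noncomputable section

open Set

namespace Literature.Probability.Percolation

open LatticeModels HalfAnnulus Tube

namespace Slot

variable {P : LParams} {σ : Slot}

/-! ### Facts about the entries and exit runs

`omega` is always run on a small context (`clear * - …` first): its exact elimination blows up
on the full list of facts of a rung. -/

/-- **The entry of the open arm** is a piece of the ring outside the window (`SepOK`). [folklore] -/
theorem gEo_facts (hV : P.Valid) (hσ : σ.InRange P) (hadm : σ.Admissible P) (hsep : σ.SepOK P) :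
    latIdx P.s P.rB (σ.ξo P) < P.nB ∧ σ.gEo P < 12 * P.nB - 4 ∧ (σ.gEo P < σ.loB P ∨ σ.hiB P < σ.gEo P) ∧
      -(P.rB : ℤ) + (latIdx P.s P.rB (σ.ξo P) : ℕ) * P.s ≤ σ.ξo P ∧ σ.ξo P < -(P.rB : ℤ) + ((latIdx P.s P.rB (σ.ξo P) : ℕ) + 1) * P.s := by
  obtain ⟨⟨hs, hk₀, hkμ, hw1, hw2, he1, he2, hε1, hε2⟩, ⟨hrB1, hrB2, hrW1, hrW2, hm, hN, hn, hμn, hR₀, hR₀n⟩,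
    ⟨hko1, hko2, hkc1, hkc2, hLB, hLW, hWB, hWW⟩, -, ⟨ha1, ha2, ha3, ha4, hξo, hξc, -, -, -, -⟩⟩ := ifacts hV hσ hadm
  obtain ⟨-, -, -, -, -, -, -, -, -, -, hnB, -, -, -, -, -, -, -⟩ := hV.facts
  obtain ⟨hι1, hι2, hnB1, hlo, hhi, hhi', hhi'', hξ1, hξ2⟩ := windowB_facts hV hσ hadm
  have hs1 : 1 ≤ P.s := by clear * - hs hk₀; omega
  have hξlo : -(P.rB : ℤ) ≤ σ.ξo P := by clear * - hξo ha2 hrB2 hR₀ hs hkμ; omega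
  have hξneg : σ.ξo P < 0 := by clear * - hξo ha1 hko2 hw1 hkμ hR₀ hk₀; omega
  have hspec := latIdx_spec (r := P.rB) (s := P.s) hs1 hξlo
  set ιo := latIdx P.s P.rB (σ.ξo P) with hιo
  have hιon : ιo < P.nB := latIdx_lt (n := P.nB) hnB1 hnB hξneg
  have hgEo : σ.gEo P = piecePos P.nB σ.io ιo := rfl
  have hblock := piecePos_mem_block' hnB1 hσ.hio hιon
  refine ⟨hιon, ?_, ?_, hspec.1, hspec.2⟩
  · rw [hgEo]; exact piecePos_lt hnB1 hσ.hio hιon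
  · rw [hgEo]
    by_cases hii : σ.io = σ.ic
    · -- same side: the lateral indices are at least `5` apart
      have hgap : σ.To P + 8 * σ.ko P < σ.Tc P + P.w ∨ σ.Tc P + 8 * σ.kc P < σ.To P + P.w := by
        rcases hsep with h | h | h
        · exact absurd hii h
        · exact Or.inl h
        · exact Or.inr h
      have hss : (P.s : ℤ) - 1 < P.s := sub_one_lt _
      have hs0 : 0 < P.s := hs1
      rcases hgap with hgap | hgap
      · have h5 : ιo + 5 ≤ σ.ιc P := by
          refine idx_le_of_mul_le (s := P.s) (c := (P.s : ℤ) - 1) hs0 ?_ hss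
          rw [Nat.cast_add, Nat.cast_ofNat]
          linarith only [hspec.1, hξ2, hgap, hξo, hξc, hkc1, hko1, hs, hw1, hk₀]
        rw [hii]
        by_cases h2 : σ.ic % 3 = 2
        · right; unfold Slot.hiB Slot.loB; rw [piecePos_eq_of_two h2, if_pos h2]; clear * - h5 hιon hι1 hι2; omega
        · left; unfold Slot.loB; rw [piecePos_eq_of_ne h2, if_neg h2]; clear * - h5 hιon hι1 hι2; omega
      · have h5 : σ.ιc P + 5 ≤ ιo := by
          refine idx_le_of_mul_le (s := P.s) (c := (P.s : ℤ) - 1) hs0 ?_ hss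
          rw [Nat.cast_add, Nat.cast_ofNat]
          linarith only [hspec.2, hξ1, hgap, hξo, hξc, hkc1, hko1, hs, hw1, hk₀]
        rw [hii]
        by_cases h2 : σ.ic % 3 = 2
        · left; unfold Slot.loB; rw [piecePos_eq_of_two h2, if_pos h2]; clear * - h5 hιon hι1 hι2; omega
        · right; unfold Slot.hiB Slot.loB; rw [piecePos_eq_of_ne h2, if_neg h2]; clear * - h5 hιon hι1 hι2; omega
    · -- different sides: the blocks are disjoint
      rcases Nat.lt_or_gt_of_ne hii with hlt | hlt
      · left
        exact Nat.lt_of_lt_of_le hblock.2 ((blockEnd_le_blockOff hlt hσ.hic).trans hlo)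
      · right
        exact Nat.lt_of_lt_of_le hhi' ((blockEnd_le_blockOff hlt hσ.hio).trans hblock.1)

/-- **The exit run of the open arm** consists of pieces of the side `0` outside the window and spans
the target rows. [folklore] -/
theorem runB_facts (hV : P.Valid) (hK : 1 ≤ P.K) (hσ : σ.InRange P) (hadm : σ.Admissible P) :
    σ.xo P + P.d < P.nB ∧ (∀ g, 2 * σ.xo P ≤ g → g ≤ 2 * σ.xo P + 2 * P.d → g < σ.loB P ∨ σ.hiB P < g) ∧
      -(P.rB : ℤ) + (σ.xo P : ℕ) * P.s - P.e ≤ σ.tgo P ∧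
      σ.tgo P + (P.n / 64 : ℕ) ≤ -(P.rB : ℤ) + ((σ.xo P : ℕ) + P.d) * P.s - P.e := by
  obtain ⟨⟨hs, hk₀, hkμ, hw1, hw2, he1, he2, hε1, hε2⟩, ⟨hrB1, hrB2, hrW1, hrW2, hm, hN, hn, hμn, hR₀, hR₀n⟩,
    ⟨hko1, hko2, hkc1, hkc2, hLB, hLW, hWB, hWW⟩, ⟨h81, h82, h41, h42, h641, h642⟩, ⟨ha1, ha2, ha3, ha4, hξo, hξc, ht1, ht2, -, -⟩⟩ :=
    ifacts hV hσ hadm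
  obtain ⟨-, -, -, -, -, -, -, -, -, -, hnB, -, -, -, -, -, -, -⟩ := hV.facts
  obtain ⟨hι1, hι2, hnB1, hlo, hhi, hhi', hhi'', hξ1, hξ2⟩ := windowB_facts hV hσ hadm
  have hnB' : ((P.nB : ℕ) : ℤ) * P.s = P.rB := by exact_mod_cast hnB
  have hμ32 := mu_ge (P := P) hK
  have hs1 : 1 ≤ P.s := by clear * - hs hk₀; omega
  have hs0 : 0 < P.s := hs1
  have hss : (P.s : ℤ) - 1 < P.s := sub_one_lt _
  have he0 : (0 : ℤ) ≤ P.e := by positivity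
  have htlo : -(P.rB : ℤ) ≤ σ.tgo P := by clear * - ht1 hrB2 hm hμn hs hkμ hn; omega
  have hn16 : 16 ≤ P.n := by clear * - hn; omega
  have hspec := latIdx_spec (r := P.rB) (s := P.s) hs1 htlo
  have hxo : σ.xo P = latIdx P.s P.rB (σ.tgo P) := rfl
  have hd : P.d = P.n / 64 / P.s + 3 := rfl
  have hds1 : ((P.n / 64 / P.s : ℕ) : ℤ) * P.s ≤ (P.n / 64 : ℕ) := by exact_mod_cast Nat.div_mul_le_self _ _
  have hds2 : ((P.n / 64 : ℕ) : ℤ) < ((P.n / 64 / P.s : ℕ) : ℤ) * P.s + P.s := by exact_mod_cast Nat.lt_div_mul_add hs0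
  have hxd : σ.xo P + P.d < P.nB := by
    have : σ.xo P + P.d + 1 ≤ P.nB := by
      refine idx_le_of_mul_le (s := P.s) (c := 0) hs0 ?_ (by exact_mod_cast hs0)
      rw [hxo, hd]; simp only [Nat.cast_add, Nat.cast_ofNat, Nat.cast_one]
      linarith only [hspec.1, hds1, ht2, hnB', h42, h641, hμn, hs, hkμ, hn]
    clear * - this; omega
  have hlo' : -(P.rB : ℤ) + (σ.xo P : ℕ) * P.s - P.e ≤ σ.tgo P := by
    rw [hxo]; linarith only [hspec.1, he0]
  refine ⟨hxd, fun g hg1 hg2 => ?_, hlo', ?_⟩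
  · by_cases hic0 : σ.ic = 0
    · -- the window sits on the side `0`: the danger zone keeps it away from the run
      have hgap := tgtRow_false_add_le (n := P.n) hn16
      have hloB : σ.loB P = 2 * (σ.ιc P - 1) := by
        unfold Slot.loB; rw [hic0, if_neg (by decide)]; simp only [blockOff, Nat.zero_add]
      have hDdef : σ.bo P = !decide (σ.ic = 0 ∧ Danger P (σ.ξc P)) := rfl
      by_cases hD : Danger P (σ.ξc P)
      · have hbo : σ.bo P = false := by rw [hDdef, hic0]; simp [hD]
        have htgo' : σ.tgo P = tgtRow P.n false := by show tgtRow P.n (σ.bo P) = _; rw [hbo]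
        unfold Danger at hD
        have : σ.xo P + P.d + 2 ≤ σ.ιc P := by
          refine idx_le_of_mul_le (s := P.s) (c := (P.s : ℤ) - 1) hs0 ?_ hss
          rw [hxo, hd]; simp only [Nat.cast_add, Nat.cast_ofNat]
          linarith only [hspec.1, hds1, hξ2, hD.1, htgo', hgap, h42, h641, hμn, hs, hμ32, hkμ, hn]
        left; clear * - hloB hg2 this; omega
      · have hbo : σ.bo P = true := by rw [hDdef]; simp [hD]
        have htgo' : σ.tgo P = tgtRow P.n true := by show tgtRow P.n (σ.bo P) = _; rw [hbo]
        unfold Danger at hD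
        rcases lt_or_ge (σ.ξc P) (tgtRow P.n true - (P.n / 64 : ℕ) - P.μ - 8 * P.s) with hlt | hge
        · have : σ.ιc P + 2 ≤ σ.xo P := by
            refine idx_le_of_mul_le (s := P.s) (c := (P.s : ℤ) - 1) hs0 ?_ hss
            rw [hxo]; simp only [Nat.cast_add, Nat.cast_ofNat]
            linarith only [hspec.2, hξ1, hlt, htgo', hμn, hn, hs, hk₀]
          right; clear * - hhi hloB hg1 hι1 this; omega
        · have hgt : tgtRow P.n true + (P.n / 64 : ℕ) + P.μ + 8 * P.s < σ.ξc P := by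
            by_contra h; exact hD ⟨hge, not_lt.1 h⟩
          have : σ.xo P + P.d + 2 ≤ σ.ιc P := by
            refine idx_le_of_mul_le (s := P.s) (c := (P.s : ℤ) - 1) hs0 ?_ hss
            rw [hxo, hd]; simp only [Nat.cast_add, Nat.cast_ofNat]
            linarith only [hspec.1, hds1, hξ2, hgt, htgo', hμn, hn, hs, hk₀]
          left; clear * - hloB hg2 this; omega
    · -- the window sits on a later side: after the block of the side `0`
      left
      have h1 : 1 ≤ σ.ic := Nat.pos_of_ne_zero hic0
      have : blockEnd P.nB 0 ≤ σ.loB P := (blockEnd_le_blockOff h1 hσ.hic).trans hlo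
      simp only [blockEnd] at this
      clear * - this hg2 hxd; omega
  · rw [hxo, hd]
    simp only [Nat.cast_add, Nat.cast_ofNat]
    linarith only [hspec.2, hds2, he1, hs, hk₀]

/-- **The entry of the closed arm** is a piece of its ring outside the window of ring `W`. [folklore] -/
theorem gEc_facts (hV : P.Valid) (hσ : σ.InRange P) (hadm : σ.Admissible P) :
    latIdx P.s P.rW (σ.ξc P) < P.nW ∧ σ.gEc P < 12 * P.nW - 4 ∧ (σ.gEc P < σ.loW P ∨ σ.hiW P < σ.gEc P) ∧
      -(P.rW : ℤ) + (latIdx P.s P.rW (σ.ξc P) : ℕ) * P.s ≤ σ.ξc P ∧ σ.ξc P < -(P.rW : ℤ) + ((latIdx P.s P.rW (σ.ξc P) : ℕ) + 1) * P.s := by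
  obtain ⟨⟨hs, hk₀, hkμ, hw1, hw2, he1, he2, hε1, hε2⟩, ⟨hrB1, hrB2, hrW1, hrW2, hm, hN, hn, hμn, hR₀, hR₀n⟩,
    ⟨hko1, hko2, hkc1, hkc2, hLB, hLW, hWB, hWW⟩, ⟨h81, h82, h41, h42, h641, h642⟩, ⟨ha1, ha2, ha3, ha4, hξo, hξc, ht1, ht2, -, -⟩⟩ :=
    ifacts hV hσ hadm
  obtain ⟨-, -, -, -, -, -, -, -, -, -, -, hnW, -, -, -, -, -, -⟩ := hV.facts
  obtain ⟨hnW1, hlohi, hhi, hlo3, hhi4, -, -, -, -⟩ := windowW_facts (σ := σ) hV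
  have hic' : σ.ic' < 6 := Nat.mod_lt _ (by norm_num)
  have hs1 : 1 ≤ P.s := by clear * - hs hk₀; omega
  have hs0 : 0 < P.s := hs1
  have hss : (P.s : ℤ) - 1 < P.s := sub_one_lt _
  have hξlo : -(P.rW : ℤ) ≤ σ.ξc P := by clear * - hξc ha4 hrW2 hR₀ hs hkμ hm hn hμn; omega
  have hξneg : σ.ξc P < 0 := by clear * - hξc ha3 hkc2 hw1 hkμ hR₀ hk₀; omega
  have htlo : -(P.rW : ℤ) ≤ σ.tgo P - (P.n / 64 : ℕ) := by clear * - ht1 hrW2 hm hμn hs hkμ hn; omega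
  have hthi : -(P.rW : ℤ) ≤ σ.tgo P + (P.n / 64 : ℕ) := by clear * - ht1 hrW2 hm hμn hs hkμ hn; omega
  have hn16 : 16 ≤ P.n := by clear * - hn; omega
  have hspec := latIdx_spec (r := P.rW) (s := P.s) hs1 hξlo
  set ι := latIdx P.s P.rW (σ.ξc P) with hι
  have hιn : ι < P.nW := latIdx_lt (n := P.nW) hnW1 hnW hξneg
  have hgEc : σ.gEc P = piecePos P.nW σ.ic' ι := rfl
  have hblock := piecePos_mem_block' hnW1 hic' hιn
  refine ⟨hιn, ?_, ?_, hspec.1, hspec.2⟩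
  · rw [hgEc]; exact piecePos_lt hnW1 hic' hιn
  · rw [hgEc]
    by_cases h3 : σ.ic' = 3
    · -- the closed tip sits on side `0` (its colour-exchanged frame is `3`): the danger zone
      have hic0 : σ.ic = 0 := by
        have := hσ.hic; unfold Slot.ic' at h3; clear * - this h3; omega
      have hylo' := latIdx_spec (r := P.rW) (s := P.s) hs1 htlo
      have hyhi' := latIdx_spec (r := P.rW) (s := P.s) hs1 hthi
      have hgap := tgtRow_false_add_le (n := P.n) hn16
      have hpos : piecePos P.nW 3 ι = blockOff P.nW 3 + 2 * ι := piecePos_eq_of_ne (by decide)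
      rw [h3, hpos]
      unfold Slot.loW Slot.hiW Slot.yLo Slot.yHi
      have hDdef : σ.bo P = !decide (σ.ic = 0 ∧ Danger P (σ.ξc P)) := rfl
      by_cases hD : Danger P (σ.ξc P)
      · have hbo : σ.bo P = false := by rw [hDdef, hic0]; simp [hD]
        have htgo' : σ.tgo P = tgtRow P.n false := by show tgtRow P.n (σ.bo P) = _; rw [hbo]
        unfold Danger at hD
        have : latIdx P.s P.rW (σ.tgo P + (P.n / 64 : ℕ)) + 2 ≤ ι := by
          refine idx_le_of_mul_le (s := P.s) (c := (P.s : ℤ) - 1) hs0 ?_ hss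
          simp only [Nat.cast_add, Nat.cast_ofNat]
          linarith only [hyhi'.1, hspec.2, hD.1, htgo', hgap, h42, h641, hμn, hs, hkμ, hn]
        right; clear * - this; omega
      · have hbo : σ.bo P = true := by rw [hDdef]; simp [hD]
        have htgo' : σ.tgo P = tgtRow P.n true := by show tgtRow P.n (σ.bo P) = _; rw [hbo]
        unfold Danger at hD
        rcases lt_or_ge (σ.ξc P) (tgtRow P.n true - (P.n / 64 : ℕ) - P.μ - 8 * P.s) with hlt | hge
        · have : ι + 2 ≤ latIdx P.s P.rW (σ.tgo P - (P.n / 64 : ℕ)) := by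
            refine idx_le_of_mul_le (s := P.s) (c := (P.s : ℤ) - 1) hs0 ?_ hss
            simp only [Nat.cast_add, Nat.cast_ofNat]
            linarith only [hspec.1, hylo'.2, hlt, htgo', hμn, hn, hs, hk₀]
          left; clear * - this; omega
        · have hgt : tgtRow P.n true + (P.n / 64 : ℕ) + P.μ + 8 * P.s < σ.ξc P := by
            by_contra h; exact hD ⟨hge, not_lt.1 h⟩
          have : latIdx P.s P.rW (σ.tgo P + (P.n / 64 : ℕ)) + 2 ≤ ι := by
            refine idx_le_of_mul_le (s := P.s) (c := (P.s : ℤ) - 1) hs0 ?_ hss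
            simp only [Nat.cast_add, Nat.cast_ofNat]
            linarith only [hyhi'.1, hspec.2, hgt, htgo', hμn, hn, hs, hk₀]
          right; clear * - this; omega
    · -- another side: the blocks are disjoint
      rcases Nat.lt_or_gt_of_ne h3 with hlt | hlt
      · left
        exact Nat.lt_of_lt_of_le hblock.2 ((blockEnd_le_blockOff hlt (by norm_num)).trans hlo3)
      · right
        have h4 : blockOff P.nW 4 ≤ blockOff P.nW σ.ic' := by
          rcases Nat.lt_or_ge 4 σ.ic' with h | h
          · exact (blockOff_le_blockEnd (by norm_num)).trans (blockEnd_le_blockOff h hic')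
          · have : σ.ic' = 4 := by clear * - h hlt; omega
            rw [this]
        exact Nat.lt_of_lt_of_le hhi4 (h4.trans hblock.1)

/-! ### The moves -/

/-- **The open arm of the slot lands**: `blackArm σ ∩ blackCorr σ ⊆ sepOpenArm n N`. [cite: Nolin2008, §4.3 Prop. 12 and §4.4 (arXiv 0711.4948: Prop. 11, Thm. 10)] -/
theorem blackArm_inter_blackCorr_subset (hV : P.Valid) (hK : 1 ≤ P.K) (hσ : σ.InRange P) (hadm : σ.Admissible P)
    (hsep : σ.SepOK P) : σ.blackArm P ∩ σ.blackCorr P ⊆ sepOpenArm P.n P.N := by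
  obtain ⟨⟨hs, hk₀, hkμ, hw1, hw2, he1, he2, hε1, hε2⟩, ⟨hrB1, hrB2, hrW1, hrW2, hm, hN, hn, hμn, hR₀, hR₀n⟩,
    ⟨hko1, hko2, hkc1, hkc2, hLB, hLW, hWB, hWW⟩, -, -⟩ := ifacts hV hσ hadm
  obtain ⟨-, -, -, -, -, -, -, -, -, -, hnB, -, -, hmN, -, -, -, -⟩ := hV.facts
  obtain ⟨hι1, hι2, hnB1, hlo, hhi, -, hhi'', -, -⟩ := windowB_facts hV hσ hadm
  obtain ⟨hιon, hgEo, hgout, hξo1, hξo2⟩ := gEo_facts hV hσ hadm hsep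
  obtain ⟨hxd, hrun, hrlo, hrhi⟩ := runB_facts hV hK hσ hadm
  -- arithmetic side conditions of the landing move (small `omega` contexts)
  have a1 : 4 * P.w ≤ σ.ko P := by clear * - hw1 hko1; omega
  have a2 : 4 ≤ σ.ko P := by clear * - hk₀ hko1; omega
  have a3 : 4 * P.ε ≤ σ.ko P := by clear * - hε1 hko1; omega
  have a4 : 2 * σ.ko P ≤ P.LB := by clear * - hLB hko2 hkμ; omega
  have a5 : 1 ≤ P.s := by clear * - hs hk₀; omega
  have a6 : P.s ≤ P.rB := by clear * - hrB2 hm hμn hs hkμ hn; omega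
  have a7 : 2 * P.e ≤ P.rB := by clear * - hrB2 hm hμn hs hkμ hn he1; omega
  have a8 : 64 ≤ P.n := by clear * - hn; omega
  have a9 : (P.n : ℤ) + P.s + 2 * P.e ≤ P.rB := by clear * - hrB2 hm hμn hs hkμ he1 hn; omega
  have a10 : (P.rB : ℤ) + 2 * P.e ≤ P.m := by clear * - hrB1 he1 hkμ hk₀; omega
  have a11 : (P.n : ℤ) + 2 * σ.ko P + P.LB ≤ P.m + 1 := by clear * - hm hko2 hLB hμn hs hkμ he1; omega
  have a12 : (P.n : ℤ) + 5 * σ.ko P ≤ P.m := by clear * - hm hko2 hμn; omega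
  have a13 : 4 * σ.ko P ≤ P.R₀ := by clear * - hko2 hR₀; omega
  have a14 : P.ε ≤ P.e := by clear * - hε1 he2 hk₀; omega
  have a15 : (P.m : ℤ) - 2 * σ.ko P + 1 + P.s + P.e + P.ε ≤ P.rB + P.LB := by clear * - hrB2 hLB hε1 he1 hko1 hk₀ hs; omega
  have a16 : (P.rB : ℤ) + P.e + P.ε ≤ (P.m : ℤ) - 2 * σ.ko P + 1 + (σ.ko P / 4 : ℕ) := by
    clear * - hrB1 he1 hε1 hko2 hk₀ hkμ; omega
  have a17 : σ.loB P ≤ σ.hiB P := by clear * - hhi; omega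
  have hlen : (thinRing P.rB P.e P.s).length = 12 * P.nB - 4 := by rw [length_thinRing hnB1]; rfl
  have harcEq : arc (thinRing P.rB P.e P.s) (σ.aB P) P.lenB =
      arc (thinRing P.rB P.e P.s) (σ.hiB P + 1) ((thinRing P.rB P.e P.s).length - (σ.hiB P - σ.loB P + 1)) := by
    rw [hlen]; unfold LParams.lenB; rw [hhi, Nat.add_sub_cancel_left]; rfl
  rintro ω ⟨⟨zo, uo, hzo, hOut, Fo, hj, hwin1, hwin2, hb⟩, ⟨⟨⟨⟨hBc, hSp⟩, harc⟩, hH⟩, hVt⟩⟩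
  have hkoF : Fo.k = σ.ko P := by show trapScale P.k₀ Fo.j = trapScale P.k₀ σ.jo; rw [hj]
  -- the entry piece
  have hgl : σ.gEo P < (thinRing P.rB P.e P.s).length := by rw [hlen]; exact hgEo
  have hTe : (thinRing P.rB P.e P.s)[σ.gEo P] ∈ arc (thinRing P.rB P.e P.s) (σ.aB P) P.lenB := by
    rw [harcEq]; exact getElem_mem_arc_compl a17 (by rw [hlen]; exact hhi'') _ hgout
  have hTeq : (thinRing P.rB P.e P.s)[σ.gEo P] = pieceTube P.rB P.e P.s P.nB σ.io (latIdx P.s P.rB (σ.ξo P)) := by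
    have h := getElem?_thinRing (e := P.e) hnB1 (show σ.gEo P < 12 * (P.rB / P.s) - 4 from hgEo)
    rw [List.getElem?_eq_getElem hgl, Option.some.injEq] at h
    rw [h]
    exact ringTube_piecePos hnB1 hσ.hio hιon
  rw [hTeq] at hTe
  refine landing_move hσ.hio hzo hOut Fo hb (T₀ := σ.To P) (w := P.w) (by rw [hkoF]; exact a1) (by rw [hkoF]; exact a2)
    ⟨hwin1, hwin2⟩ (by rw [hkoF]; exact hBc) (L := P.LB) (ε := P.ε) (by rw [hkoF]; exact a3) (by rw [hkoF]; exact a4)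
    (by rw [hkoF]; exact hSp) a5 ⟨_, by rw [← hnB, mul_comm]⟩ a6 a7 harc hTe ?_ (b := σ.bo P) (j₀ := σ.xo P) (d := P.d)
    ?_ hrlo hrhi hWB hH hVt a8 a9 a10 hmN (by rw [hkoF]; exact a11) (by rw [hkoF]; exact a12) (by rw [hkoF]; exact a13)
  · -- the spoke meets the entry piece
    rw [hkoF]
    exact spokeMeets_pieceTube hσ.hio hnB hιon ⟨hξo1, hξo2⟩ a14 a15 a16
  · -- the exit run lies in the arc
    intro T hT
    obtain ⟨g, hg1, hg2, hgT⟩ := exists_pos_of_mem_vchunks (by exact hxd) hT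
    rw [harcEq]
    have hg' : g < 12 * P.nB - 4 := by clear * - hg2 hxd; omega
    have hg : g < (thinRing P.rB P.e P.s).length := by rw [hlen]; exact hg'
    have h := getElem?_thinRing (e := P.e) hnB1 (show g < 12 * (P.rB / P.s) - 4 from hg')
    rw [hgT, List.getElem?_eq_getElem hg, Option.some.injEq] at h
    rw [← h]
    exact getElem_mem_arc_compl a17 (by rw [hlen]; exact hhi'') hg (hrun g hg1 hg2)

/-- **The closed arm of the slot lands**: `whiteArm σ ∩ whiteCorr σ ⊆ negFlip ⁻¹' sepOpenArm n N`. [cite: Nolin2008, §4.3 Prop. 12 and §4.4 (arXiv 0711.4948: Prop. 11, Thm. 10)] -/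
theorem whiteArm_inter_whiteCorr_subset (hV : P.Valid) (hσ : σ.InRange P) (hadm : σ.Admissible P) :
    σ.whiteArm P ∩ σ.whiteCorr P ⊆ negFlip ⁻¹' sepOpenArm P.n P.N := by
  obtain ⟨⟨hs, hk₀, hkμ, hw1, hw2, he1, he2, hε1, hε2⟩, ⟨hrB1, hrB2, hrW1, hrW2, hm, hN, hn, hμn, hR₀, hR₀n⟩,
    ⟨hko1, hko2, hkc1, hkc2, hLB, hLW, hWB, hWW⟩, -, -⟩ := ifacts hV hσ hadm
  obtain ⟨-, -, -, -, -, -, -, -, -, -, -, hnW, -, hmN, -, -, -, -⟩ := hV.facts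
  obtain ⟨hnW1, hlohi, hhi, -, -, hxd, hrunlt, hrlo, hrhi⟩ := windowW_facts (σ := σ) hV
  obtain ⟨hιn, hgEc, hgout, hξ1, hξ2⟩ := gEc_facts hV hσ hadm
  have hic' : σ.ic' < 6 := Nat.mod_lt _ (by norm_num)
  -- arithmetic side conditions of the landing move (small `omega` contexts)
  have a1 : 4 * P.w ≤ σ.kc P := by clear * - hw1 hkc1; omega
  have a2 : 4 ≤ σ.kc P := by clear * - hk₀ hkc1; omega
  have a3 : 4 * P.ε ≤ σ.kc P := by clear * - hε1 hkc1; omega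
  have a4 : 2 * σ.kc P ≤ P.LW := by clear * - hLW hkc2 hkμ; omega
  have a5 : 1 ≤ P.s := by clear * - hs hk₀; omega
  have a6 : P.s ≤ P.rW := by clear * - hrW2 hm hμn hs hkμ hn; omega
  have a7 : 2 * P.e ≤ P.rW := by clear * - hrW2 hm hμn hs hkμ hn he1; omega
  have a8 : 64 ≤ P.n := by clear * - hn; omega
  have a9 : (P.n : ℤ) + P.s + 2 * P.e ≤ P.rW := by clear * - hrW2 hm hμn hs hkμ he1 hn; omega
  have a10 : (P.rW : ℤ) + 2 * P.e ≤ P.m := by clear * - hrW1 he1 hkμ hk₀; omega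
  have a11 : (P.n : ℤ) + 2 * σ.kc P + P.LW ≤ P.m + 1 := by clear * - hm hkc2 hLW hμn hs hkμ he1; omega
  have a12 : (P.n : ℤ) + 5 * σ.kc P ≤ P.m := by clear * - hm hkc2 hμn; omega
  have a13 : 4 * σ.kc P ≤ P.R₀ := by clear * - hkc2 hR₀; omega
  have a14 : P.ε ≤ P.e := by clear * - hε1 he2 hk₀; omega
  have a15 : (P.m : ℤ) - 2 * σ.kc P + 1 + P.s + P.e + P.ε ≤ P.rW + P.LW := by clear * - hrW2 hLW hε1 he1 hkc1 hk₀ hs; omega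
  have a16 : (P.rW : ℤ) + P.e + P.ε ≤ (P.m : ℤ) - 2 * σ.kc P + 1 + (σ.kc P / 4 : ℕ) := by
    clear * - hrW1 he1 hε1 hkc2 hk₀ hkμ; omega
  have hlen : (thinRing P.rW P.e P.s).length = 12 * P.nW - 4 := by rw [length_thinRing hnW1]; rfl
  have harcEq : arc (thinRing P.rW P.e P.s) (σ.aW P) (σ.lenW P) =
      arc (thinRing P.rW P.e P.s) (σ.hiW P + 1) ((thinRing P.rW P.e P.s).length - (σ.hiW P - σ.loW P + 1)) := by
    rw [hlen]; rfl
  rintro ω ⟨⟨zc, uc, hzc, hOut, Fc, hj, hwin1, hwin2, hb⟩, hC⟩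
  obtain ⟨⟨⟨⟨hBc, hSp⟩, harc⟩, hH⟩, hVt⟩ := (hC : negFlip ω ∈ corrEvent σ.ic' P.m P.n (σ.kc P) (σ.Tc P) P.w P.LW P.ε P.rW P.e P.s
    (σ.aW P) (σ.lenW P) (σ.tgc P) P.WW)
  have hkcF : Fc.k = σ.kc P := by show trapScale P.k₀ Fc.j = trapScale P.k₀ σ.jc; rw [hj]
  have hgl : σ.gEc P < (thinRing P.rW P.e P.s).length := by rw [hlen]; exact hgEc
  have hTe : (thinRing P.rW P.e P.s)[σ.gEc P] ∈ arc (thinRing P.rW P.e P.s) (σ.aW P) (σ.lenW P) := by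
    rw [harcEq]; exact getElem_mem_arc_compl hlohi (by rw [hlen]; exact hhi) _ hgout
  have hTeq : (thinRing P.rW P.e P.s)[σ.gEc P] = pieceTube P.rW P.e P.s P.nW σ.ic' (latIdx P.s P.rW (σ.ξc P)) := by
    have h := getElem?_thinRing (e := P.e) hnW1 (show σ.gEc P < 12 * (P.rW / P.s) - 4 from hgEc)
    rw [List.getElem?_eq_getElem hgl, Option.some.injEq] at h
    rw [h]
    exact ringTube_piecePos hnW1 hic' hιn
  rw [hTeq] at hTe
  refine white_landing_move hσ.hic hzc hOut Fc hb (T₀ := σ.Tc P) (w := P.w) (by rw [hkcF]; exact a1) (by rw [hkcF]; exact a2)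
    ⟨hwin1, hwin2⟩ (by rw [hkcF]; exact hBc) (L := P.LW) (ε := P.ε) (by rw [hkcF]; exact a3) (by rw [hkcF]; exact a4)
    (by rw [hkcF]; exact hSp) a5 ⟨_, by rw [← hnW, mul_comm]⟩ a6 a7 harc hTe ?_ (b := σ.bc P) (j₀ := σ.xc P) (d := P.d)
    ?_ hrlo hrhi hWW hH hVt a8 a9 a10 hmN (by rw [hkcF]; exact a11) (by rw [hkcF]; exact a12) (by rw [hkcF]; exact a13)
  · rw [hkcF]
    exact spokeMeets_pieceTube hic' hnW hιn ⟨hξ1, hξ2⟩ a14 a15 a16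
  · intro T hT
    obtain ⟨g, hg1, hg2, hgT⟩ := exists_pos_of_mem_vchunks (by exact hxd) hT
    rw [harcEq]
    have hg' : g < 12 * P.nW - 4 := by clear * - hg2 hxd; omega
    have hg : g < (thinRing P.rW P.e P.s).length := by rw [hlen]; exact hg'
    have h := getElem?_thinRing (e := P.e) hnW1 (show g < 12 * (P.rW / P.s) - 4 from hg')
    rw [hgT, List.getElem?_eq_getElem hg, Option.some.injEq] at h
    rw [← h]
    have hlt : g < σ.loW P := by clear * - hrunlt hg2; omega
    exact getElem_mem_arc_compl hlohi (by rw [hlen]; exact hhi) hg (Or.inl hlt)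

/-- **The four slot events force the well-separated two-arm event**:
`blackArm ∩ whiteArm ∩ (blackCorr ∩ whiteCorr) ⊆ sepTwoArm n N`. [cite: Nolin2008, §4.3 Prop. 12 (arXiv 0711.4948: Prop. 11)] -/
theorem inter_subset_sepTwoArm (hV : P.Valid) (hK : 1 ≤ P.K) (hσ : σ.InRange P) (hadm : σ.Admissible P) (hsep : σ.SepOK P) :
    σ.blackArm P ∩ σ.whiteArm P ∩ (σ.blackCorr P ∩ σ.whiteCorr P) ⊆ sepTwoArm P.n P.N := by
  rintro ω ⟨⟨hbA, hwA⟩, hbC, hwC⟩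
  exact ⟨blackArm_inter_blackCorr_subset hV hK hσ hadm hsep ⟨hbA, hbC⟩, whiteArm_inter_whiteCorr_subset hV hσ hadm ⟨hwA, hwC⟩⟩

end Slot

end Literature.Probability.Percolation
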